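import Literature.Combinatorics.SimpleGraph.PaleySelfComplementary
import Literature.Combinatorics.SimpleGraph.LasserreCliqueCover
import Literature.Combinatorics.SimpleGraph.LasserreFiniteConvergence
import HarnessLib

/-!
# The Paley graph: `las⁽ᵗ⁾(P̄_p) = las⁽ᵗ⁾(P_p)`, `las⁽ᵗ⁾ ≤ 3` on the moduli `3s`, `las⁽ᵗ⁾(P_p) < √p`
for `t ≥ p`

Consequences of `PaleySelfComplementary.lean` through the tools of `LasserreCliqueCover.lean`
(isomorphism invariance, clique-cover bound), PROVED, for the crux
`Summit.PneNP.PneNP.Theses.RamseyUncertifiable.PaleySosRung` (stmt-PneNP-9817):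

* `lasserreStableBound_compl_paleyGraph : las⁽ᵗ⁾(P̄_p) = las⁽ᵗ⁾(P_p)` (`p` prime, `p ≡ 1 (mod 4)`,
  `t ≥ 1`) — turns the vendored `kuniskyYu2022_theorem_1_2` (stated for `P̄_p`) into the level-`2`
  rung of the crux, and makes `SosUncertainty → PaleySosRung` immediate (`η = δ/2`);
* `lasserreStableBound_paleyGraph_three_mul_le : las⁽ᵗ⁾ ≤ 3` for the square-difference graph on
  `ℤ/(3s)ℤ`, `s ≡ 3 (mod 4)` prime, `3 ∤ s` — primality is load-bearing in the crux;
* `cliqueNum_paleyGraph_eq_indepNum : ω(P_p) = α(P_p)` (through `indepNum_le_of_iso`);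
* `lasserreStableBound_paleyGraph_lt_sqrt_of_card_le : las⁽ᵗ⁾(P_p) < √p` for `t ≥ p` (finite
  convergence `las⁽ᵗ⁾ = α` for `t ≥ α`, Laurent 2003, tree, and `α(P_p)² ≠ p`): at every fixed prime
  the hierarchy ends strictly below its level-`1` value `√p`.

## References

* [KuniskyYu2022] D. Kunisky, X. Yu, arXiv:2211.02713, Prop. 2.6, Theorem 1.2.
-/

noncomputable section

namespace Literature.Combinatorics.SimpleGraph

open Matrix Finset

/-- **Composite moduli kill the bound**: for `p = 3s`, `s` prime, `s ≡ 3 (mod 4)`, `3 ∤ s`, the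
symmetrised square-difference graph on `ℤ/pℤ` is covered by the `3` cliques "`≡ r (mod 3)`", hence
`las⁽ᵗ⁾ ≤ 3` for all `t ≥ 1`. [folklore] -/
theorem lasserreStableBound_paleyGraph_three_mul_le {m s : ℕ} [Fact s.Prime] (hs3 : s % 4 = 3)
    (hcop : Nat.Coprime 3 s) (hm : m + 1 = 3 * s) {t : ℕ} (ht : 1 ≤ t) :
    lasserreStableBound (paleyGraph (m + 1)) t ≤ 3 := by
  have h := lasserreStableBound_le_card_of_cliqueCover (paleyGraph (m + 1))
    (fun x : ZMod (m + 1) => (((ZMod.ringEquivCongr hm).trans (ZMod.chineseRemainder hcop)) x).1)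
    (fun x y hne hxy => paleyGraph_adj_of_crt_fst_eq hs3 hcop hm x y hne hxy) ht
  calc _ ≤ (Fintype.card (ZMod 3) : ℝ) := h
    _ = 3 := by norm_num [ZMod.card]

/-- `las⁽ᵗ⁾(P̄_p) = las⁽ᵗ⁾(P_p)` (`t ≥ 1`): the transport the `t = 2` rung needs from the vendored
Kunisky–Yu fact (stated for the complement). [folklore] -/
theorem lasserreStableBound_compl_paleyGraph {p : ℕ} (hp : p.Prime) (h4 : p % 4 = 1) {t : ℕ}
    (ht : 1 ≤ t) :
    lasserreStableBound (paleyGraph p)ᶜ t = lasserreStableBound (paleyGraph p) t := by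
  obtain ⟨n, rfl⟩ : ∃ n, p = n + 1 := ⟨p - 1, (Nat.succ_pred_eq_of_pos hp.pos).symm⟩
  haveI : Fact (n + 1).Prime := ⟨hp⟩
  obtain ⟨φ⟩ := nonempty_iso_compl_paleyGraph n h4
  exact (lasserreStableBound_eq_of_iso φ ht).symm

/-- **At every prime the hierarchy eventually drops strictly below `√p`**: for `t ≥ p`, finite
convergence gives `las⁽ᵗ⁾(P_p) = α(P_p)`, and `α(P_p) < √p` because `α(P_p) ≤ las⁽¹⁾(P_p) = √p` and
`α(P_p)² = p` is impossible for a prime. [folklore] -/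
theorem lasserreStableBound_paleyGraph_lt_sqrt_of_card_le {p : ℕ} (hp : p.Prime)
    (h4 : p % 4 = 1) {t : ℕ} (hpt : p ≤ t) :
    lasserreStableBound (paleyGraph p) t < Real.sqrt p := by
  have ht : 1 ≤ t := hp.one_lt.le.trans hpt
  have hα : (paleyGraph p).indepNum ≤ t := by
    refine le_trans ?_ hpt
    obtain ⟨s, hs⟩ := (paleyGraph p).exists_isNIndepSet_indepNum
    rw [← hs.card_eq]
    exact (card_le_univ s).trans (Fintype.card_fin p).le
  rw [lasserreStableBound_eq_indepNum Laurent2003_lasserre_exact_of_indepNum_le_holds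
    (paleyGraph p) ht hα]
  have hle : ((paleyGraph p).indepNum : ℝ) ≤ Real.sqrt p :=
    (indepNum_le_lasserreStableBound (paleyGraph p) 1 le_rfl).trans
      (lasserreStableBound_paleyGraph_le_sqrt hp h4 le_rfl)
  refine lt_of_le_of_ne hle fun heq => ?_
  -- `α² = p` contradicts primality
  have hsq : ((paleyGraph p).indepNum : ℝ) ^ 2 = p := by
    rw [heq, Real.sq_sqrt (Nat.cast_nonneg p)]
  have hnat : (paleyGraph p).indepNum * (paleyGraph p).indepNum = p := by
    exact_mod_cast (show ((paleyGraph p).indepNum : ℝ) * (paleyGraph p).indepNum = p by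
      rw [← sq, hsq])
  have hdvd : (paleyGraph p).indepNum ∣ p := ⟨_, hnat.symm⟩
  rcases (Nat.dvd_prime hp).1 hdvd with h1 | h1
  · rw [h1, one_mul] at hnat
    exact hp.one_lt.ne hnat
  · rw [h1] at hnat
    have : p * p ≤ p * 1 := by rw [mul_one]; exact hnat.le
    have := Nat.le_of_mul_le_mul_left this hp.pos
    exact absurd this (not_le.2 hp.one_lt)


/-- The independence number is invariant under graph isomorphisms (`≤` half). [folklore] -/
theorem indepNum_le_of_iso {V W : Type*} [Fintype V] [DecidableEq V] [Fintype W] [DecidableEq W]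
    {G : SimpleGraph V} {G' : SimpleGraph W} (φ : G ≃g G') : G.indepNum ≤ G'.indepNum := by
  obtain ⟨s, hs⟩ := G.exists_isNIndepSet_indepNum
  rw [← hs.card_eq, ← Finset.card_map φ.toEquiv.toEmbedding]
  refine SimpleGraph.IsIndepSet.card_le_indepNum ?_
  intro x hx y hy hxy
  rw [mem_coe, Finset.mem_map] at hx hy
  obtain ⟨a, ha, rfl⟩ := hx
  obtain ⟨b, hb, rfl⟩ := hy
  have hab : a ≠ b := fun h => hxy (by rw [h])
  show ¬ G'.Adj (φ a) (φ b)
  rw [φ.map_adj_iff]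
  exact hs.isIndepSet (mem_coe.2 ha) (mem_coe.2 hb) hab

/-- `ω(P_p) = α(P_p)` for primes `p ≡ 1 (mod 4)` (self-complementarity). [folklore] -/
theorem cliqueNum_paleyGraph_eq_indepNum {p : ℕ} (hp : p.Prime) (h4 : p % 4 = 1) :
    (paleyGraph p).cliqueNum = (paleyGraph p).indepNum := by
  obtain ⟨n, rfl⟩ : ∃ n, p = n + 1 := ⟨p - 1, (Nat.succ_pred_eq_of_pos hp.pos).symm⟩
  haveI : Fact (n + 1).Prime := ⟨hp⟩
  obtain ⟨φ⟩ := nonempty_iso_compl_paleyGraph n h4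
  rw [← SimpleGraph.indepNum_compl]
  exact le_antisymm (indepNum_le_of_iso φ.symm) (indepNum_le_of_iso φ)


end Literature.Combinatorics.SimpleGraph

end
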